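/-
Copyright (c) 2026. Released under Apache 2.0 license.
-/
import Literature.NumberTheory.Automorphic.UnboundedDenominatorsInvariantHom
import Literature.GroupTheory.ArithmeticGroups.IharaAmalgamPingPong
import HarnessLib

/-!
# Invariant homomorphisms on `Γ(AB)`: cross-commutators of `Γ(A)` and `Γ(B)` die (CDT Cor. 4.5.3, gluing)

For coprime `A, B` and an `SL₂(ℤ)`-conjugation-invariant homomorphism `θ : Γ(AB) → Q` (`Q` commutative):

* `pow_gcd_eq_one_of_map_Gamma_mul` — a homomorphism `f : Γ(A) → Q` that is trivial on `Γ(AB)` satisfies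
  `f(x)^{gcd(B,12)} = 1`: it factors through `Γ(A)/Γ(AB) ≅ SL₂(ℤ/B)` (strong approximation,
  `IharaAmalgam.exists_mem_Gamma_forall_dvd_sub`), hence through a character of `SL₂(ℤ)`, which has order
  dividing `12` (`SL2Z.map_pow_twelve`) and dividing `B` on `T`;
* `map_commutatorElement_eq_one` — **`θ([x, y]) = 1` for `x ∈ Γ(A)`, `y ∈ Γ(B)`**: `x ↦ θ([x, y])` is a homomorphism on
  `Γ(A)` trivial on `Γ(AB)` and `y ↦ θ([x, y])` one on `Γ(B)`, so `θ([x,y])` has order dividing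
  `gcd(A, 12, B) = 1`.

This is the vanishing of the Künneth cross term `H₁(SL₂(ℤ/A)) ⊗ H₁(SL₂(ℤ/B))` in the Schur multiplier of
`SL₂(ℤ/AB) = SL₂(ℤ/A) × SL₂(ℤ/B)` [Beyl1986], the input for gluing the invariant form of
[CalegariDimitrovTang2025, Cor. 4.5.3] over the prime factorisation of the level.
-/

open scoped MatrixGroups commutatorElement

namespace Literature.NumberTheory.Automorphic

namespace UnboundedDenominators

open CongruenceSubgroup Matrix.SpecialLinearGroup ModularGroup
open Literature.GroupTheory.ArithmeticGroups.IharaAmalgam (exists_mem_Gamma_forall_dvd_sub)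

variable {Q : Type*} [CommGroup Q]

/-- `Γ(A) ∩ Γ(B) ≤ Γ(AB)` for coprime `A, B` (Chinese remainder theorem). [cite: DiamondShurman2005, §1.2 and Exercise 1.2.3] -/
theorem mem_Gamma_mul_of_coprime {A B : ℕ} (hAB : A.Coprime B) {x : SL(2, ℤ)} (hA : x ∈ Gamma A)
    (hB : x ∈ Gamma B) : x ∈ Gamma (A * B) := by
  have hc : IsCoprime (A : ℤ) (B : ℤ) := Nat.isCoprime_iff_coprime.mpr hAB
  obtain ⟨a00, a01, a10, a11⟩ := Gamma_mem.mp hA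
  obtain ⟨b00, b01, b10, b11⟩ := Gamma_mem.mp hB
  rw [Gamma_mem]
  have one_iff : ∀ (m : ℕ) (z : ℤ), ((z : ZMod m) = 1 ↔ (m : ℤ) ∣ z - 1) := fun m z ↦ by
    rw [show (1 : ZMod m) = ((1 : ℤ) : ZMod m) by simp, ZMod.intCast_eq_intCast_iff_dvd_sub]
    constructor <;> intro h <;> simpa [dvd_sub_comm] using h
  have zero_iff : ∀ (m : ℕ) (z : ℤ), ((z : ZMod m) = 0 ↔ (m : ℤ) ∣ z) := fun m z ↦
    ZMod.intCast_zmod_eq_zero_iff_dvd z m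
  refine ⟨?_, ?_, ?_, ?_⟩
  · rw [one_iff, Nat.cast_mul]; exact hc.mul_dvd ((one_iff A _).mp a00) ((one_iff B _).mp b00)
  · rw [zero_iff, Nat.cast_mul]; exact hc.mul_dvd ((zero_iff A _).mp a01) ((zero_iff B _).mp b01)
  · rw [zero_iff, Nat.cast_mul]; exact hc.mul_dvd ((zero_iff A _).mp a10) ((zero_iff B _).mp b10)
  · rw [one_iff, Nat.cast_mul]; exact hc.mul_dvd ((one_iff A _).mp a11) ((one_iff B _).mp b11)

/-- Entrywise congruence mod `B` means `γ⁻¹ g ∈ Γ(B)`. [cite: DiamondShurman2005, §1.2] -/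
theorem inv_mul_mem_Gamma_of_forall_dvd_sub {B : ℕ} {γ g : SL(2, ℤ)}
    (h : ∀ i j, (B : ℤ) ∣ γ i j - g i j) : γ⁻¹ * g ∈ Gamma B := by
  rw [Gamma_mem', map_mul, map_inv, inv_mul_eq_one]
  ext i j
  rw [SL_reduction_mod_hom_val, SL_reduction_mod_hom_val]
  exact ((ZMod.intCast_eq_intCast_iff_dvd_sub _ _ _).mpr (by simpa [dvd_sub_comm] using h i j)).symm

/-- **A homomorphism `Γ(A) → Q` trivial on `Γ(AB)` has exponent dividing `gcd(B, 12)`** (`A, B` coprime): it factors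
through `Γ(A)/Γ(AB) ≅ SL₂(ℤ/B)`, whose abelianisation is a quotient of `SL₂(ℤ)ᵃᵇ ≅ ℤ/12` killed by `B`
(the class of `T` has order dividing `B`). [cite: CalegariDimitrovTang2025, Corollary 4.5.3] -/
theorem pow_gcd_eq_one_of_map_Gamma_mul {A B : ℕ} (hAB : A.Coprime B) (f : Gamma A →* Q)
    (hf : ∀ (x : SL(2, ℤ)) (hx : x ∈ Gamma A), x ∈ Gamma (A * B) → f ⟨x, hx⟩ = 1)
    (x : Gamma A) : f x ^ Nat.gcd B 12 = 1 := by
  classical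
  -- lifts: every `g` is congruent mod `B` to some element of `Γ(A)`
  have hlift : ∀ g : SL(2, ℤ), ∃ γ : SL(2, ℤ), γ ∈ Gamma A ∧ γ⁻¹ * g ∈ Gamma B := fun g ↦ by
    obtain ⟨γ, hγ, h⟩ := exists_mem_Gamma_forall_dvd_sub hAB g
    exact ⟨γ, hγ, inv_mul_mem_Gamma_of_forall_dvd_sub h⟩
  choose lift hliftA hliftB using hlift
  -- `f` only depends on the class mod `Γ(B)`
  have hwd : ∀ (g γ : SL(2, ℤ)) (hγ : γ ∈ Gamma A), γ⁻¹ * g ∈ Gamma B →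
      f ⟨lift g, hliftA g⟩ = f ⟨γ, hγ⟩ := by
    intro g γ hγ hγg
    have hmem : γ⁻¹ * lift g ∈ Gamma B := by
      have : γ⁻¹ * lift g = (γ⁻¹ * g) * ((lift g)⁻¹ * g)⁻¹ := by group
      rw [this]
      exact mul_mem hγg (inv_mem (hliftB g))
    have hmemA : γ⁻¹ * lift g ∈ Gamma A := mul_mem (inv_mem hγ) (hliftA g)
    have h1 := hf (γ⁻¹ * lift g) hmemA (mem_Gamma_mul_of_coprime hAB hmemA hmem)
    have heq : (⟨γ⁻¹ * lift g, hmemA⟩ : Gamma A) = ⟨γ, hγ⟩⁻¹ * ⟨lift g, hliftA g⟩ := rfl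
    rw [heq, map_mul, map_inv, inv_mul_eq_one] at h1
    exact h1.symm
  -- the extension `F : SL₂(ℤ) →* Q`
  let F : SL(2, ℤ) →* Q := MonoidHom.mk' (fun g ↦ f ⟨lift g, hliftA g⟩) (fun g h ↦ by
    have hmemA : lift g * lift h ∈ Gamma A := mul_mem (hliftA g) (hliftA h)
    have hmemB : (lift g * lift h)⁻¹ * (g * h) ∈ Gamma B := by
      have : (lift g * lift h)⁻¹ * (g * h) =
          (lift h)⁻¹ * ((lift g)⁻¹ * g) * (lift h)⁻¹⁻¹ * ((lift h)⁻¹ * h) := by group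
      rw [this]
      exact mul_mem ((Gamma_normal B).conj_mem _ (hliftB g) (lift h)⁻¹) (hliftB h)
    show f ⟨lift (g * h), hliftA (g * h)⟩ = f ⟨lift g, hliftA g⟩ * f ⟨lift h, hliftA h⟩
    rw [hwd (g * h) _ hmemA hmemB, ← map_mul]
    rfl)
  have hF : ∀ g : SL(2, ℤ), F g = f ⟨lift g, hliftA g⟩ := fun g ↦ rfl
  have hFres : ∀ (y : SL(2, ℤ)) (hy : y ∈ Gamma A), F y = f ⟨y, hy⟩ := fun y hy ↦ by
    rw [hF, hwd y y hy (by rw [inv_mul_cancel]; exact one_mem _)]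
  -- `F(T)^B = 1` and `F(T)^12 = 1`
  have hT12 : F T ^ 12 = 1 := Literature.NumberTheory.ModularForms.SL2Z.map_pow_twelve F T
  have hTB : F T ^ B = 1 := by
    have hTBmem : T ^ (B : ℤ) ∈ Gamma B := by
      have := ModularGroup_T_pow_mem_Gamma (B : ℤ) (B : ℤ) (dvd_refl _)
      simpa using this
    rw [← zpow_natCast, ← map_zpow, hF]
    have hγB : lift (T ^ (B : ℤ)) ∈ Gamma B := by
      have : lift (T ^ (B : ℤ)) = T ^ (B : ℤ) * ((lift (T ^ (B : ℤ)))⁻¹ * T ^ (B : ℤ))⁻¹ := by group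
      rw [this]
      exact mul_mem hTBmem (inv_mem (hliftB _))
    exact hf _ (hliftA _) (mem_Gamma_mul_of_coprime hAB (hliftA _) hγB)
  have hTgcd : F T ^ Nat.gcd B 12 = 1 := pow_gcd_eq_one.mpr ⟨hTB, hT12⟩
  -- every value of `F` is a power of `F(T)`
  have hval : ∀ g : SL(2, ℤ), ∃ k : ℤ, F g = F T ^ k := by
    intro g
    have hmem : Abelianization.of g ∈ Subgroup.zpowers (Abelianization.of (T : SL(2, ℤ))) := by
      rw [Literature.NumberTheory.ModularForms.SL2Z.zpowers_of_T_eq_top]; exact Subgroup.mem_top _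
    obtain ⟨k, hk⟩ := Subgroup.mem_zpowers_iff.mp hmem
    refine ⟨k, ?_⟩
    rw [← Abelianization.lift_apply_of F g, ← hk, map_zpow, Abelianization.lift_apply_of]
  obtain ⟨k, hk⟩ := hval x
  rw [show f x = F x from by rw [hFres x.1 x.2], hk, ← zpow_natCast, ← zpow_mul, mul_comm, zpow_mul,
    zpow_natCast, hTgcd, one_zpow]

/-- `[x, y] ∈ Γ(AB)` for `x ∈ Γ(A)`, `y ∈ Γ(B)`, `A, B` coprime. [cite: DiamondShurman2005, §1.2 and Exercise 1.2.3] -/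
theorem commutatorElement_mem_Gamma_mul {A B : ℕ} (hAB : A.Coprime B) {x y : SL(2, ℤ)}
    (hx : x ∈ Gamma A) (hy : y ∈ Gamma B) : ⁅x, y⁆ ∈ Gamma (A * B) := by
  refine mem_Gamma_mul_of_coprime hAB ?_ ?_
  · rw [show ⁅x, y⁆ = x * (y * x⁻¹ * y⁻¹) by rw [commutatorElement_def]; group]
    exact mul_mem hx ((Gamma_normal A).conj_mem _ (inv_mem hx) y)
  · rw [commutatorElement_def]
    exact mul_mem ((Gamma_normal B).conj_mem _ hy x) (inv_mem hy)

/-- **Cross-commutators die.**  For coprime `A, B` and an `SL₂(ℤ)`-invariant homomorphism `θ : Γ(AB) → Q` to a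
commutative group: `θ([x, y]) = 1` for all `x ∈ Γ(A)`, `y ∈ Γ(B)`.  (`x ↦ θ([x,y])` is a homomorphism `Γ(A) → Q`
trivial on `Γ(AB)`, so of exponent `∣ gcd(B, 12)`; symmetrically `∣ gcd(A, 12)`; and `gcd(A, B) = 1`.)
[cite: CalegariDimitrovTang2025, Corollary 4.5.3] -/
theorem map_commutatorElement_eq_one {A B : ℕ} (hAB : A.Coprime B) (θ : Gamma (A * B) →* Q)
    (hθ : ∀ (g x : SL(2, ℤ)) (hx : x ∈ Gamma (A * B)) (hgx : g * x * g⁻¹ ∈ Gamma (A * B)),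
      θ ⟨g * x * g⁻¹, hgx⟩ = θ ⟨x, hx⟩)
    {x y : SL(2, ℤ)} (hx : x ∈ Gamma A) (hy : y ∈ Gamma B) :
    θ ⟨⁅x, y⁆, commutatorElement_mem_Gamma_mul hAB hx hy⟩ = 1 := by
  -- `f_y : x ↦ θ [x, y]` is a homomorphism on `Γ(A)`, trivial on `Γ(AB)`
  let fy : Gamma A →* Q := MonoidHom.mk'
    (fun x' ↦ θ ⟨⁅(x' : SL(2, ℤ)), y⁆, commutatorElement_mem_Gamma_mul hAB x'.2 hy⟩) (fun x₁ x₂ ↦ by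
      have h2 := commutatorElement_mem_Gamma_mul hAB x₂.2 hy
      have h1 := commutatorElement_mem_Gamma_mul hAB x₁.2 hy
      have hconj : (x₁ : SL(2, ℤ)) * ⁅(x₂ : SL(2, ℤ)), y⁆ * (x₁ : SL(2, ℤ))⁻¹ ∈ Gamma (A * B) :=
        (Gamma_normal (A * B)).conj_mem _ h2 _
      have heq : (⟨⁅((x₁ * x₂ : Gamma A) : SL(2, ℤ)), y⁆, commutatorElement_mem_Gamma_mul hAB (x₁ * x₂).2 hy⟩ :
          Gamma (A * B)) = ⟨_, hconj⟩ * ⟨_, h1⟩ :=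
        Subtype.ext (by simp only [Subgroup.coe_mul, commutatorElement_def]; group)
      show θ _ = θ _ * θ _
      rw [heq, map_mul, hθ _ _ h2 hconj, mul_comm])
  have hfy : ∀ (x' : SL(2, ℤ)) (hx' : x' ∈ Gamma A), x' ∈ Gamma (A * B) → fy ⟨x', hx'⟩ = 1 := by
    intro x' hx' hx'N
    have hc : y * x'⁻¹ * y⁻¹ ∈ Gamma (A * B) := (Gamma_normal (A * B)).conj_mem _ (inv_mem hx'N) y
    have heq : (⟨⁅x', y⁆, commutatorElement_mem_Gamma_mul hAB hx' hy⟩ : Gamma (A * B)) =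
        ⟨x', hx'N⟩ * ⟨y * x'⁻¹ * y⁻¹, hc⟩ :=
      Subtype.ext (by simp only [Subgroup.coe_mul, commutatorElement_def]; group)
    show θ _ = 1
    rw [heq, map_mul, hθ y x'⁻¹ (inv_mem hx'N) hc]
    rw [show (⟨x'⁻¹, inv_mem hx'N⟩ : Gamma (A * B)) = ⟨x', hx'N⟩⁻¹ from rfl, map_inv, mul_inv_cancel]
  have e1 : θ ⟨⁅x, y⁆, commutatorElement_mem_Gamma_mul hAB hx hy⟩ ^ Nat.gcd B 12 = 1 :=
    pow_gcd_eq_one_of_map_Gamma_mul hAB fy hfy ⟨x, hx⟩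
  -- `g_x : y ↦ θ [x, y]` is a homomorphism on `Γ(B)`, trivial on `Γ(BA)`
  let gx : Gamma B →* Q := MonoidHom.mk'
    (fun y' ↦ θ ⟨⁅x, (y' : SL(2, ℤ))⁆, commutatorElement_mem_Gamma_mul hAB hx y'.2⟩) (fun y₁ y₂ ↦ by
      have h1 := commutatorElement_mem_Gamma_mul hAB hx y₁.2
      have h2 := commutatorElement_mem_Gamma_mul hAB hx y₂.2
      have hconj : (y₁ : SL(2, ℤ)) * ⁅x, (y₂ : SL(2, ℤ))⁆ * (y₁ : SL(2, ℤ))⁻¹ ∈ Gamma (A * B) :=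
        (Gamma_normal (A * B)).conj_mem _ h2 _
      have heq : (⟨⁅x, ((y₁ * y₂ : Gamma B) : SL(2, ℤ))⁆, commutatorElement_mem_Gamma_mul hAB hx (y₁ * y₂).2⟩ :
          Gamma (A * B)) = ⟨_, h1⟩ * ⟨_, hconj⟩ :=
        Subtype.ext (by simp only [Subgroup.coe_mul, commutatorElement_def]; group)
      show θ _ = θ _ * θ _
      rw [heq, map_mul, hθ _ _ h2 hconj])
  have hgx : ∀ (y' : SL(2, ℤ)) (hy' : y' ∈ Gamma B), y' ∈ Gamma (B * A) → gx ⟨y', hy'⟩ = 1 := by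
    intro y' hy' hy'N
    rw [mul_comm] at hy'N
    have hc : x * y' * x⁻¹ ∈ Gamma (A * B) := (Gamma_normal (A * B)).conj_mem _ hy'N x
    have heq : (⟨⁅x, y'⁆, commutatorElement_mem_Gamma_mul hAB hx hy'⟩ : Gamma (A * B)) =
        ⟨x * y' * x⁻¹, hc⟩ * ⟨y', hy'N⟩⁻¹ :=
      Subtype.ext (by simp only [Subgroup.coe_mul, Subgroup.coe_inv, commutatorElement_def])
    show θ _ = 1
    rw [heq, map_mul, map_inv, hθ x y' hy'N hc, mul_inv_cancel]
  have e2 : θ ⟨⁅x, y⁆, commutatorElement_mem_Gamma_mul hAB hx hy⟩ ^ Nat.gcd A 12 = 1 :=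
    pow_gcd_eq_one_of_map_Gamma_mul hAB.symm gx hgx ⟨y, hy⟩
  -- `gcd(gcd(B,12), gcd(A,12)) = 1`
  have hcop : Nat.Coprime (Nat.gcd B 12) (Nat.gcd A 12) :=
    Nat.Coprime.coprime_dvd_left (Nat.gcd_dvd_left B 12)
      (Nat.Coprime.coprime_dvd_right (Nat.gcd_dvd_left A 12) hAB.symm)
  have h3 : orderOf (θ ⟨⁅x, y⁆, commutatorElement_mem_Gamma_mul hAB hx hy⟩) ∣
      Nat.gcd (Nat.gcd B 12) (Nat.gcd A 12) :=
    Nat.dvd_gcd (orderOf_dvd_of_pow_eq_one e1) (orderOf_dvd_of_pow_eq_one e2)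
  rw [Nat.Coprime.gcd_eq_one hcop, Nat.dvd_one] at h3
  exact orderOf_eq_one_iff.mp h3

end UnboundedDenominators

end Literature.NumberTheory.Automorphic
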